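import Summits.QuantumFields.BalabanUV.T4Continuum.Support.ShellMeasurePlaquetteCubicLocal
import Summits.QuantumFields.BalabanUV.T4Continuum.Support.ShellMeasureCommutatorLocGrad

/-!
# `T4Continuum.ShellMeasurePlaquetteCubicDictionary` — row S65 f5d (part a, file 1∕2): THE `mainTerm` ↔ `cub`
# DICTIONARY — leaf-03's twisted variables are b08's plaquette variables `x₁ … x₄` up to the scalar `i` and a conjugation
# by the BACKGROUND PLAQUETTE HOLONOMY `U₀(∂p)`; the symmetrised one-grid Wilson functional's order-≥3 part is
# b08∕leaf-05's cubic commutator density PLUS a `∇`-FREE remainder `V0remCov`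
# (cell `pub-balaban`, sub-cell `t4`, spine estimate NE7c (node U5b), crew lineage `b2b-balaban-t4-ne7c-formalise-leaf-02`
# gen 8, owner table `LEAVES-NE7c-P1.md` row S65; imports leaf-03-g4's S65 f4 file 6 `ShellMeasurePlaquetteCubicLocal`
# (p223811) and this lineage's f5a `ShellMeasureCommutatorLocGrad` (p222728) ONLY; [folklore]; 0 sorry)

HONEST FRAMING.  Finite four-torus programme, rung (B)+1 only — NOT infinite volume, NOT a mass gap, NOT the Clay
problem, NOT summit progress; (B), `BetaPertHyp`, (B^μ) are not consumed.  NE7c (`T4IndicatorShell.ShellWeightBound`)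
is NOT PRINTED and NOT PROVED; «NE7c ⇐ the named binders» (WALL `t4/b2b-balaban-t4-ne7c-p1/WALL-NE7c-P1.md` §2).
ELEMENTARY algebra in a normed algebra ([folklore]); [Balaban1985Variational] (34)∕(39) are LOCATORS for the shape only —
the paper is under adjudication; nothing printed is asserted or cited as a fact; no `def … : Prop` is minted (the `def`s
`fv`, `mainFlatSym`, `V0remCov` are DATA, in the currency of leaf-03's `tv`, `mainTermSym`, `V0remSym`).
HONEST DEPENDENCY (cell): continuum YM on T⁴ ⇐ BetaPertH ∧ nine spine estimates (0/9 proved); BetaPertH ⇐ (D1) ∧ (D4)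
∧ CAP+tail; G-an2-4 gates asym, D1 and NE2/3/4.

THE POINT.  Row S65 splits the order-≥3 part of the one-grid plaquette action à la (39): a curl × commutator MAIN TERM
(whose gradient needs the `∇`-norm and the summation by parts of leaf-05-g7's S65 f3, packaged multi-grid by this
lineage's f5a∕f5b∕f5c as `Prop4Hyp` of `locGrad (cubT …)`) plus a remainder with a SMALL cubic binder (the `∇`-free part:
f2b∕f2c, binder discharged at one grid by leaf-03-g4's S65 f4).  The two crews typed the main term in two currencies:
leaf-03 (`ShellMeasurePlaquetteCubicLocal.mainTermSym = −¼·τ(Y·K + K·Y)`, `Y`, `K` the curl and commutator sum of the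
four TWISTED variables `tv` of (34)), leaf-05∕b08 (`ShellMeasureCommutatorVariation.cub w τ η U₀ B p =
w·τ((D^η_{U₀}B)(p)·{…}_B(p))` on b08's `X1 … X4`).  THIS FILE is the dictionary (identities only; the estimates, locality
and analyticity of `V0remCov` are file 2∕2 `ShellMeasurePlaquetteCubicCovBinders`):
* §1 `tv` made explicit for a boundary oriented `(+, +, −, −)` (b08's `p_{μν}(x) = ⟨x, x+e_μ, x+e_μ+e_ν, x+e_ν⟩`):
  `tv 0 = i·A(b₀)`, `tv 1 = R(U(b₀))(i·A(b₁))`, `tv 2 = R(U₀(∂p))·R(U(b₃))(−i·A(b₂))`, `tv 3 = R(U₀(∂p))(−i·A(b₃))`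
  (`R(u)X = uXu⁻¹`; `U₀(∂p) = plaqWord U bd 0 = U(b₀)U(b₁)U(b₂)⁻¹U(b₃)⁻¹` the BACKGROUND plaquette holonomy); the FLAT
  variables `fv` (the same without `R(U₀(∂p))`), `mainFlatSym := −¼·τ(Z·K_Z + K_Z·Z)` on them, and
  **`V0remCov := ord₃ (plaqFunSym) − mainFlatSym`** (= leaf-03's `V0remSym` + the ROTATION REMAINDER `mainTermSym − mainFlatSym`,
  `V0remCov_eq`);
* §3 the b08 INSTANTIATION: on a finite bond set `Λ ⊂ Site d × Fin d` with `U b := U₀ b.1 b.2` and `bd` the boundary of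
  the increasing plaquette `(μ, ν, x)`: `fv i = i·Xᵢ(ext Λ A)` (`fv_eq_X`), `curl4 fv = i·lin`, `comm4 fv = −brk`,
  **`mainFlatSym_eq`**: `mainFlatSym = (i∕4)·τ(lin·brk + brk·lin)` for EVERY `τ`, **`mainFlatSym_eq_cub`**:
  `= cub (iη∕2) τ η U₀ (ext Λ A) μ ν x` for a TRACIAL `τ` (`η ≠ 0`; `cub` reads `(D^η B)(p) = η⁻¹·lin`), and the SUM
  over a plaquette family **`sum_ord₃_eq_cubT_add`**:
  `Σ_{p∈Pl} ord₃ (plaqFunSym τ U (bd p)) A = cubT Λ Pl (iη∕2) τ η U₀ A + Σ_{p∈Pl} V0remCov τ U (bd p) A`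
  — the one-grid action's order-≥3 part IS (f5a∕f5b∕f5c's `∇`-part functional `cubT`, weight `w = iη∕2`) + (a `∇`-free
  plaquette family).  Part b differentiates this identity (`locGrad`) and assembles the two `Prop4Hyp`s by f2c `Prop4Hyp.add`.
NOT HERE: the three binders of `V0remCov` (file 2∕2), the weights∕`η`-currency at the live levels (J1, leaf-01-g6), the
HD-dressing (S66), [dict] (node O).  No estimate of Bałaban's at a live level is discharged.
-/

noncomputable section

open scoped BigOperators

namespace Summit.QuantumFields.BalabanUV.T4Continuum.ShellMeasurePlaquetteCubicDictionary

open Literature.MathematicalPhysics.QuantumFieldTheory.Balaban1983to89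
open B7Prop1Explicit (e U1 mem_U1)
open B7Eq78Linearization (conjR conjR_apply conjR_add conjR_sub conjR_smul)
open B8Eq146AExpansion (X1 X2 X3 X4 lin adR plaqCovDeriv)
open B8Eq151V2Divergence (brk)
open ShellMeasureWilsonGradientTail (letter plaqWord bonds)
open ShellMeasurePlaquetteTwist (twistVar letter_zero plaqFunSym)
open ShellMeasurePlaquetteCubicSlice (norm_plaqWord_zero_le norm_inv_plaqWord_zero_le)
open ShellMeasurePlaquetteCubicSplit (pre tv)
open ShellMeasurePlaquetteCubicLocal (mainTermSym V0remSym norm_V0remSym_le_of_bonds fst_mem_bonds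
  ord₃_plaqFunSym_add_single analyticAt_ord₃ analyticAt_mainTermSym)
open ShellMeasureCubicWord (curl4 comm4)
open ShellMeasureLocalGradientTailJet (ord₃)
open Summit.QuantumFields.BalabanUV.T4Continuum.ShellMeasureCommutatorVariation (cub)
open Summit.QuantumFields.BalabanUV.T4Continuum.ShellMeasureCommutatorLocGrad (ext ext_apply_of_mem cubT cubT_apply)

export B7Prop1Explicit (Site)

variable {Λ : Type*} {𝔸 : Type*} [NormedRing 𝔸] [NormedAlgebra ℂ 𝔸] [CompleteSpace 𝔸]

/-! ## §0 Conjugation algebra -/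

section Conj

omit [NormedAlgebra ℂ 𝔸] [CompleteSpace 𝔸] in
/-- `‖R(u)Y‖ ≤ ‖Y‖` for a unit-bounded `u`. [folklore] -/
theorem norm_conjR_le {u : 𝔸ˣ} (hu : ‖(u : 𝔸)‖ ≤ 1) (hu' : ‖((u⁻¹ : 𝔸ˣ) : 𝔸)‖ ≤ 1) (Y : 𝔸) :
    ‖conjR u Y‖ ≤ ‖Y‖ := by
  rw [conjR_apply]
  calc _ ≤ ‖(u : 𝔸)‖ * ‖Y‖ * ‖((u⁻¹ : 𝔸ˣ) : 𝔸)‖ := norm_mul₃_le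
    _ ≤ 1 * ‖Y‖ * 1 := by gcongr
    _ = ‖Y‖ := by ring

omit [NormedAlgebra ℂ 𝔸] [CompleteSpace 𝔸] in
/-- THE ROTATION DEFECT: `‖R(W)Y − Y‖ ≤ 2ε·‖Y‖` when `‖W − 1‖, ‖W⁻¹ − 1‖ ≤ ε` and `‖W⁻¹‖ ≤ 1`
(`R(W)Y − Y = (W − 1)·Y·W⁻¹ + Y·(W⁻¹ − 1)`). [folklore] -/
theorem norm_conjR_sub_self_le {W : 𝔸ˣ} {ε : ℝ} (hW : ‖(W : 𝔸) - 1‖ ≤ ε) (hW' : ‖((W⁻¹ : 𝔸ˣ) : 𝔸) - 1‖ ≤ ε)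
    (hWi : ‖((W⁻¹ : 𝔸ˣ) : 𝔸)‖ ≤ 1) (Y : 𝔸) : ‖conjR W Y - Y‖ ≤ 2 * ε * ‖Y‖ := by
  have hε : 0 ≤ ε := (norm_nonneg _).trans hW
  have h : conjR W Y - Y = ((W : 𝔸) - 1) * Y * ((W⁻¹ : 𝔸ˣ) : 𝔸) + Y * (((W⁻¹ : 𝔸ˣ) : 𝔸) - 1) := by
    rw [conjR_apply]
    noncomm_ring
  rw [h]
  calc _ ≤ ‖((W : 𝔸) - 1) * Y * ((W⁻¹ : 𝔸ˣ) : 𝔸)‖ + ‖Y * (((W⁻¹ : 𝔸ˣ) : 𝔸) - 1)‖ := norm_add_le _ _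
    _ ≤ ‖(W : 𝔸) - 1‖ * ‖Y‖ * ‖((W⁻¹ : 𝔸ˣ) : 𝔸)‖ + ‖Y‖ * ‖((W⁻¹ : 𝔸ˣ) : 𝔸) - 1‖ :=
        add_le_add norm_mul₃_le (norm_mul_le _ _)
    _ ≤ ε * ‖Y‖ * 1 + ‖Y‖ * ε := by gcongr
    _ = 2 * ε * ‖Y‖ := by ring

end Conj

/-! ## §1 The twisted variables made explicit for a `(+, +, −, −)` boundary; the flat variables -/

section Twist

/-- The background word as a product of four letters. [folklore] -/
theorem plaqWord_zero_eq_prod (U : Λ → 𝔸ˣ) (bd : Fin 4 → Λ × Bool) :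
    plaqWord U bd (0 : Λ → 𝔸) =
      letter U 0 (bd 0) * letter U 0 (bd 1) * letter U 0 (bd 2) * letter U 0 (bd 3) := by
  have hl : List.ofFn bd = [bd 0, bd 1, bd 2, bd 3] := by simp [List.ofFn_succ]
  unfold plaqWord
  rw [hl]
  simp [mul_assoc]

variable (U : Λ → 𝔸ˣ) (bd : Fin 4 → Λ × Bool)
  (h0 : (bd 0).2 = true) (h1 : (bd 1).2 = true) (h2 : (bd 2).2 = false) (h3 : (bd 3).2 = false)

/-- THE FLAT VARIABLES of a `(+, +, −, −)` boundary: `i·A(b₀)`, `R(U(b₀))(i·A(b₁))`, `R(U(b₃))(−i·A(b₂))`, `−i·A(b₃)` —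
the twisted variables WITHOUT the background plaquette holonomy (in the b08 instantiation: `i·x₁, …, i·x₄`, §3).
[folklore] -/
def fv (A : Λ → 𝔸) : Fin 4 → 𝔸
  | ⟨0, _⟩ => Complex.I • A (bd 0).1
  | ⟨1, _⟩ => conjR (U (bd 0).1) (Complex.I • A (bd 1).1)
  | ⟨2, _⟩ => conjR (U (bd 3).1) (-(Complex.I • A (bd 2).1))
  | ⟨3, _⟩ => -(Complex.I • A (bd 3).1)

omit [CompleteSpace 𝔸] in
/-- [folklore] -/
theorem fv_zero (A : Λ → 𝔸) : fv U bd A 0 = Complex.I • A (bd 0).1 := rfl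

omit [CompleteSpace 𝔸] in
/-- [folklore] -/
theorem fv_one (A : Λ → 𝔸) : fv U bd A 1 = conjR (U (bd 0).1) (Complex.I • A (bd 1).1) := rfl

omit [CompleteSpace 𝔸] in
/-- [folklore] -/
theorem fv_two (A : Λ → 𝔸) : fv U bd A 2 = conjR (U (bd 3).1) (-(Complex.I • A (bd 2).1)) := rfl

omit [CompleteSpace 𝔸] in
/-- [folklore] -/
theorem fv_three (A : Λ → 𝔸) : fv U bd A 3 = -(Complex.I • A (bd 3).1) := rfl

include h0 h1 h2 h3

/-- **THE BACKGROUND PLAQUETTE HOLONOMY** of a `(+, +, −, −)` boundary: `U₀(∂p) = U(b₀)·U(b₁)·U(b₂)⁻¹·U(b₃)⁻¹`.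
[folklore] -/
theorem plaqWord_zero_eq : plaqWord U bd (0 : Λ → 𝔸) = U (bd 0).1 * U (bd 1).1 * (U (bd 2).1)⁻¹ * (U (bd 3).1)⁻¹ := by
  rw [plaqWord_zero_eq_prod, letter_zero, letter_zero, letter_zero, letter_zero, if_pos h0, if_pos h1,
    if_neg (by simp [h2]), if_neg (by simp [h3])]

omit h1 h2 h3 in
/-- `tv 0 = i·A(b₀)` ([Balaban1985Variational] (34) TYPE: the first letter is untwisted). [folklore] -/
theorem tv_zero (A : Λ → 𝔸) : tv U bd A 0 = fv U bd A 0 := by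
  show twistVar U (pre U bd 0) (bd 0) A = _
  rw [fv_zero, show pre U bd 0 = 1 from rfl]
  unfold twistVar
  rw [if_pos h0, conjR_apply]
  simp

omit h2 h3 in
/-- `tv 1 = R(U(b₀))(i·A(b₁))`. [folklore] -/
theorem tv_one (A : Λ → 𝔸) : tv U bd A 1 = fv U bd A 1 := by
  show twistVar U (pre U bd 1) (bd 1) A = _
  rw [fv_one, show pre U bd 1 = 1 * letter U 0 (bd 0) from rfl, one_mul, letter_zero, if_pos h0]
  unfold twistVar
  rw [if_pos h1]

/-- `tv 2 = R(U₀(∂p))·R(U(b₃))(−i·A(b₂))` — the third letter sees the background plaquette holonomy. [folklore] -/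
theorem tv_two (A : Λ → 𝔸) : tv U bd A 2 = conjR (plaqWord U bd 0) (fv U bd A 2) := by
  show twistVar U (pre U bd 2) (bd 2) A = _
  -- `R(Wu) = R(W)R(u)` (`B7Prop3GeneralRotated.conjR_mul_left`, not imported here)
  have hmul : ∀ (W u : 𝔸ˣ) (Y : 𝔸), conjR (W * u) Y = conjR W (conjR u Y) := fun W u Y => by
    simp only [conjR_apply, Units.val_mul, mul_inv_rev, mul_assoc]
  rw [fv_two, show pre U bd 2 = 1 * letter U 0 (bd 0) * letter U 0 (bd 1) from rfl, one_mul, letter_zero,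
    letter_zero, if_pos h0, if_pos h1, plaqWord_zero_eq U bd h0 h1 h2 h3, ← hmul, inv_mul_cancel_right]
  unfold twistVar
  rw [if_neg (by simp [h2]), neg_smul]

/-- `tv 3 = R(U₀(∂p))(−i·A(b₃))` — so does the fourth. [folklore] -/
theorem tv_three (A : Λ → 𝔸) : tv U bd A 3 = conjR (plaqWord U bd 0) (fv U bd A 3) := by
  show twistVar U (pre U bd 3) (bd 3) A = _
  rw [fv_three, show pre U bd 3 = 1 * letter U 0 (bd 0) * letter U 0 (bd 1) * letter U 0 (bd 2) from rfl, one_mul,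
    letter_zero, letter_zero, letter_zero, if_pos h0, if_pos h1, if_neg (by simp [h2]),
    plaqWord_zero_eq U bd h0 h1 h2 h3]
  unfold twistVar
  rw [if_neg (by simp [h3]), neg_smul]

end Twist

/-! ## §1b The flat main term and the remainder relative to it -/

section Defs

variable (τ : 𝔸 →L[ℂ] ℂ) (U : Λ → 𝔸ˣ) (bd : Fin 4 → Λ × Bool)

/-- THE FLAT MAIN TERM `−¼·τ(Z·K_Z + K_Z·Z)`, `Z = Σᵢ zᵢ`, `K_Z = Σ_{i<j}[zᵢ, zⱼ]` on the flat variables `zᵢ = fv i` —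
leaf-03's `mainTermSym` with the background plaquette holonomy replaced by `1` (in the b08 instantiation:
`(i∕4)·τ((D B)(p)·{…}_B(p) + {…}_B(p)·(D B)(p))`, §3). [folklore] -/
def mainFlatSym (A : Λ → 𝔸) : ℂ :=
  -((4 : ℂ)⁻¹ * τ (curl4 (fv U bd A 0) (fv U bd A 1) (fv U bd A 2) (fv U bd A 3)
      * comm4 (fv U bd A 0) (fv U bd A 1) (fv U bd A 2) (fv U bd A 3)
    + comm4 (fv U bd A 0) (fv U bd A 1) (fv U bd A 2) (fv U bd A 3)
      * curl4 (fv U bd A 0) (fv U bd A 1) (fv U bd A 2) (fv U bd A 3)))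

variable [Fintype Λ]

/-- **THE `∇`-FREE PART** `V0remCov := ord₃ (plaqFunSym) − mainFlatSym` = leaf-03's `V₀′` PLUS the rotation remainder
`mainTermSym − mainFlatSym` (print's `V₀′(A, ∂p)` of (39) is DEFINED by the split; ours is the split relative to the
b08∕leaf-05 main term). [folklore] -/
def V0remCov (A : Λ → 𝔸) : ℂ := ord₃ (plaqFunSym τ U bd) A - mainFlatSym τ U bd A

/-- The split: `ord₃ (plaqFunSym τ U bd) A = mainFlatSym + V0remCov` (by definition). [folklore] -/
theorem ord₃_plaqFunSym_split_cov (A : Λ → 𝔸) :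
    ord₃ (plaqFunSym τ U bd) A = mainFlatSym τ U bd A + V0remCov τ U bd A := by
  simp [V0remCov]

/-- `V0remCov = V0remSym + (mainTermSym − mainFlatSym)`. [folklore] -/
theorem V0remCov_eq (A : Λ → 𝔸) :
    V0remCov τ U bd A = V0remSym τ U bd A + (mainTermSym τ U bd A - mainFlatSym τ U bd A) := by
  simp [V0remCov, V0remSym]

end Defs

/-! ## §3 The b08 instantiation: flat variables = `i·xᵢ`, flat main term = the cubic commutator density -/

section B08

variable {d : ℕ} (Λ : Finset (Site d × Fin d)) (τ : 𝔸 →L[ℂ] ℂ) (U₀ : Site d → Fin d → 𝔸ˣ)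
  (bd : Fin 4 → ↥Λ × Bool) {μ ν : Fin d} {x : Site d}
  (hb0 : ((bd 0).1 : Site d × Fin d) = (x, μ)) (hb1 : ((bd 1).1 : Site d × Fin d) = (x + e μ, ν))
  (hb2 : ((bd 2).1 : Site d × Fin d) = (x + e ν, μ)) (hb3 : ((bd 3).1 : Site d × Fin d) = (x, ν))

omit [NormedAlgebra ℂ 𝔸] [CompleteSpace 𝔸] in
/-- On a bond of `Λ` named by a letter, the extended field is the field at that letter. [folklore] -/
theorem ext_eq_of_letter (A : ↥Λ → 𝔸) {b : ↥Λ} {y : Site d} {κ : Fin d} (hb : (b : Site d × Fin d) = (y, κ)) :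
    ext Λ A y κ = A b := by
  have hmem : (y, κ) ∈ Λ := hb ▸ b.2
  rw [ext_apply_of_mem Λ A hmem]
  congr 1
  exact Subtype.ext hb.symm

include hb0 hb1 hb2 hb3

omit [CompleteSpace 𝔸] in
/-- **THE FLAT VARIABLES ARE b08's PLAQUETTE VARIABLES**: with `U b := U₀ b.1 b.2` and `bd` the boundary of
`p_{μν}(x)`, `fv 0 = i·x₁`, `fv 1 = i·x₂`, `fv 2 = i·x₃`, `fv 3 = i·x₄` of `B8Eq146AExpansion` at `B = ext Λ A`. [folklore] -/
theorem fv_eq_X (A : ↥Λ → 𝔸) :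
    fv (fun b : ↥Λ => U₀ b.1.1 b.1.2) bd A 0 = Complex.I • X1 (ext Λ A) μ x ∧
    fv (fun b : ↥Λ => U₀ b.1.1 b.1.2) bd A 1 = Complex.I • X2 U₀ (ext Λ A) μ ν x ∧
    fv (fun b : ↥Λ => U₀ b.1.1 b.1.2) bd A 2 = Complex.I • X3 U₀ (ext Λ A) μ ν x ∧
    fv (fun b : ↥Λ => U₀ b.1.1 b.1.2) bd A 3 = Complex.I • X4 (ext Λ A) ν x := by
  refine ⟨?_, ?_, ?_, ?_⟩
  · rw [fv_zero, X1, ext_eq_of_letter Λ A hb0]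
  · simp only [fv_one, X2, ext_eq_of_letter Λ A hb1, conjR_smul, hb0]
  · simp only [fv_two, X3, ext_eq_of_letter Λ A hb2, ← smul_neg, conjR_smul, hb3]
  · rw [fv_three, X4, ext_eq_of_letter Λ A hb3, smul_neg]

omit [CompleteSpace 𝔸] in
/-- `curl4 fv = i·lin` and `comm4 fv = −brk` (`i² = −1`). [folklore] -/
theorem curl4_fv_eq (A : ↥Λ → 𝔸) :
    curl4 (fv (fun b : ↥Λ => U₀ b.1.1 b.1.2) bd A 0) (fv (fun b : ↥Λ => U₀ b.1.1 b.1.2) bd A 1)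
        (fv (fun b : ↥Λ => U₀ b.1.1 b.1.2) bd A 2) (fv (fun b : ↥Λ => U₀ b.1.1 b.1.2) bd A 3) =
      Complex.I • lin U₀ (ext Λ A) μ ν x ∧
    comm4 (fv (fun b : ↥Λ => U₀ b.1.1 b.1.2) bd A 0) (fv (fun b : ↥Λ => U₀ b.1.1 b.1.2) bd A 1)
        (fv (fun b : ↥Λ => U₀ b.1.1 b.1.2) bd A 2) (fv (fun b : ↥Λ => U₀ b.1.1 b.1.2) bd A 3) =
      -brk U₀ (ext Λ A) μ ν x := by
  obtain ⟨e0, e1, e2, e3⟩ := fv_eq_X Λ U₀ bd hb0 hb1 hb2 hb3 A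
  rw [e0, e1, e2, e3]
  refine ⟨?_, ?_⟩
  · simp only [curl4, lin, smul_add]
  · simp only [comm4, brk, adR, smul_mul_smul_comm, Complex.I_mul_I, neg_smul, one_smul, neg_add, sub_eq_add_neg,
      neg_neg]

omit [CompleteSpace 𝔸] hb0 hb1 hb2 hb3 in
/-- `(c·L)(−K) + (−K)(c·L) = −c·(L·K + K·L)`. [folklore] -/
theorem smul_mul_neg_sym (c : ℂ) (L K : 𝔸) : (c • L) * (-K) + (-K) * (c • L) = -(c • (L * K + K * L)) := by
  simp only [smul_mul_assoc, mul_smul_comm, mul_neg, neg_mul, smul_neg, smul_add, neg_add]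

omit [CompleteSpace 𝔸] in
/-- **THE FLAT MAIN TERM IS THE SYMMETRISED CUBIC COMMUTATOR DENSITY**: `mainFlatSym = (i∕4)·τ(lin·brk + brk·lin)` —
for EVERY continuous linear `τ`. [folklore] -/
theorem mainFlatSym_eq (A : ↥Λ → 𝔸) :
    mainFlatSym τ (fun b : ↥Λ => U₀ b.1.1 b.1.2) bd A =
      Complex.I / 4 * τ (lin U₀ (ext Λ A) μ ν x * brk U₀ (ext Λ A) μ ν x
        + brk U₀ (ext Λ A) μ ν x * lin U₀ (ext Λ A) μ ν x) := by
  obtain ⟨hc, hk⟩ := curl4_fv_eq Λ U₀ bd hb0 hb1 hb2 hb3 A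
  rw [mainFlatSym, hc, hk, smul_mul_neg_sym, map_neg, map_smul, smul_eq_mul]
  ring

omit [CompleteSpace 𝔸] in
/-- … and for a TRACIAL `τ` it is leaf-05's `cub` with the weight `w = iη∕2`:
`mainFlatSym = (i∕2)·τ(lin·brk) = cub (iη∕2) τ η U₀ (ext Λ A) μ ν x` (`η ≠ 0`; `cub` reads `(D^η B)(p) = η⁻¹·lin`).
[folklore] -/
theorem mainFlatSym_eq_cub (htr : ∀ P Q : 𝔸, τ (P * Q) = τ (Q * P)) {η : ℝ} (hη : η ≠ 0) (A : ↥Λ → 𝔸) :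
    mainFlatSym τ (fun b : ↥Λ => U₀ b.1.1 b.1.2) bd A = cub (Complex.I * η / 2) τ η U₀ (ext Λ A) μ ν x := by
  rw [mainFlatSym_eq Λ τ U₀ bd hb0 hb1 hb2 hb3, map_add, htr (brk U₀ (ext Λ A) μ ν x) (lin U₀ (ext Λ A) μ ν x), cub,
    plaqCovDeriv, smul_mul_assoc, ContinuousLinearMap.map_smul_of_tower, Complex.real_smul, Complex.ofReal_inv]
  have hη' : (η : ℂ) ≠ 0 := by exact_mod_cast hη
  field_simp
  ring

/-- **(39) IN b08's CURRENCY, ONE PLAQUETTE**: `ord₃ (plaqFunSym τ U bd) A = cub (iη∕2) τ η U₀ (ext Λ A) p + V0remCov τ U bd A`.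
[folklore] -/
theorem ord₃_plaqFunSym_eq_cub_add (htr : ∀ P Q : 𝔸, τ (P * Q) = τ (Q * P)) {η : ℝ} (hη : η ≠ 0) (A : ↥Λ → 𝔸) :
    ord₃ (plaqFunSym τ (fun b : ↥Λ => U₀ b.1.1 b.1.2) bd) A =
      cub (Complex.I * η / 2) τ η U₀ (ext Λ A) μ ν x + V0remCov τ (fun b : ↥Λ => U₀ b.1.1 b.1.2) bd A := by
  rw [ord₃_plaqFunSym_split_cov, mainFlatSym_eq_cub Λ τ U₀ bd hb0 hb1 hb2 hb3 htr hη]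

end B08

/-! ## §3b The sum over a plaquette family: `Σ_p ord₃ = cubT + Σ_p V0remCov` -/

section Family

variable {d : ℕ} (Λ : Finset (Site d × Fin d)) (Pl : Finset (Fin d × Fin d × Site d)) (τ : 𝔸 →L[ℂ] ℂ)
  (U₀ : Site d → Fin d → 𝔸ˣ) (bd : Fin d × Fin d × Site d → (Fin 4 → ↥Λ × Bool))

/-- **THE ONE-GRID ACTION'S ORDER-≥3 PART = THE `∇`-PART FUNCTIONAL + A `∇`-FREE PLAQUETTE FAMILY.**  For a finite family
`Pl` of plaquettes `p = (μ, ν, x)` of b08's lattice whose boundaries `bd p` (letters in the finite bond set `Λ`, oriented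
`(+, +, −, −)`) are those of `p_{μν}(x)`, a tracial `τ` and `η ≠ 0`:
`Σ_{p∈Pl} ord₃ (plaqFunSym τ U (bd p)) A = cubT Λ Pl (iη∕2) τ η U₀ A + Σ_{p∈Pl} V0remCov τ U (bd p) A` with
`U b = U₀ b.1 b.2` — f5a∕f5b∕f5c's `cubT` IS the main term of the actual action, the rest carries the three binders of §2.
[folklore] -/
theorem sum_ord₃_eq_cubT_add (htr : ∀ P Q : 𝔸, τ (P * Q) = τ (Q * P)) {η : ℝ} (hη : η ≠ 0)
    (hbd : ∀ p ∈ Pl, ((bd p 0).1 : Site d × Fin d) = (p.2.2, p.1) ∧ ((bd p 1).1 : Site d × Fin d) = (p.2.2 + e p.1, p.2.1)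
      ∧ ((bd p 2).1 : Site d × Fin d) = (p.2.2 + e p.2.1, p.1) ∧ ((bd p 3).1 : Site d × Fin d) = (p.2.2, p.2.1))
    (A : ↥Λ → 𝔸) :
    ∑ p ∈ Pl, ord₃ (plaqFunSym τ (fun b : ↥Λ => U₀ b.1.1 b.1.2) (bd p)) A =
      cubT Λ Pl (Complex.I * η / 2) τ η U₀ A + ∑ p ∈ Pl, V0remCov τ (fun b : ↥Λ => U₀ b.1.1 b.1.2) (bd p) A := by
  rw [cubT_apply, ← Finset.sum_add_distrib]
  refine Finset.sum_congr rfl fun p hp => ?_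
  obtain ⟨h0, h1, h2, h3⟩ := hbd p hp
  exact ord₃_plaqFunSym_eq_cub_add Λ τ U₀ (bd p) h0 h1 h2 h3 htr hη A

end Family

end Summit.QuantumFields.BalabanUV.T4Continuum.ShellMeasurePlaquetteCubicDictionary

end
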